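import Summits.QuantumFields.YangMills.Theorems.FemtoTransferGapBlockToFineCross
import HarnessLib

/-!
# Femto transfer gap — the BLOCK CROSS datum of two once-block-dressed vectors is controlled by their DRESSED BLOCK DEFECTS (Cauchy–Schwarz)
# (crux `DressedRitz`, stmt-QuantumFields-20205, line «polyakovlift» r9; LEAD prover ym-lead-20205-polyakovlift g4)

Skeleton r9 asks, in `stub_blockPosition`, for the block cross clause (B6) `|⟨u_i,K^Lu_l⟩ − ((X̄_i+X̄_l)/2)⟨u_i,u_l⟩| ≤ Cλ²λ₀^L‖u_i‖‖u_l‖` at `L`-free precision `λ²`,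
and, in `stub_blockLeakage`, for dressed block defects `⟨u,K^{2L}u⟩‖u‖² ≤ (1+δ)⟨u,K^Lu⟩²` at `δ = Cλ³`.  This file records that (B6) is NOT independent content
once the defects are one power sharper: since `‖K^Lu − X̄u‖² = δ_u·X̄²‖u‖²` EXACTLY (`X̄ = ⟨u,K^Lu⟩/‖u‖²`, `δ_u` the dressed block defect), Cauchy–Schwarz gives

* ★ `SpecSum.blockCross_of_variance` (pure real, spectral sums) and ★ `BlockToFine.blockCross_of_defects` (tree currency):
  `|⟨u,K^ℓu'⟩ − ((X̄+X̄')/2)·⟨u,u'⟩| ≤ √δ·((X̄+X̄')/2)·‖u‖‖u'‖` whenever both dressed block defects are `≤ δ` (`δ > 0`).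

So a supplier delivering dressed block defects at `δ = Cλ⁴` (the one-loop size: first-order level mixing, `(λ·‖𝔥₁f‖)²`-type) gets (B6) at `√C·λ²` for free; at r9's `δ = Cλ³`
it gives only `λ^{3/2}` — which is why r9 keeps (B6) as a clause (one power of `λ` to spare in `stub_blockLeakage`).  Recorded as a by-name alternative, not a reshape.

HONEST FRAMING: fixed-lattice linear algebra for the CONDITIONAL femto rung R2b1; nothing here bears on infinite volume, the continuum limit or the Clay gap.
References: Reed–Simon IV, Thm. XIII.1 [cite: ReedSimonIV1978, Thm. XIII.1].
-/

set_option autoImplicit false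

noncomputable section

open MeasureTheory Filter Topology Real Finset
open scoped BigOperators
open Literature.MathematicalPhysics.QuantumFieldTheory
open Literature.MathematicalPhysics.QuantumLattice

namespace Summit.QuantumFields.YangMills.Theorems.FemtoTransferGap

namespace SpecSum

variable {lam a b : ℕ → ℝ} {ℓ : ℕ} {Na Ta Qa Nb Nab Tab δ : ℝ}

/-- ★ **Block cross from the dressed variance** (pure real).  With `N_a = Σλ^{2ℓ}a²`, `T_a = Σλ^{3ℓ}a²`, `Q_a = Σλ^{4ℓ}a²`, `N_b = Σλ^{2ℓ}b²`, `N_ab = Σλ^{2ℓ}ab`,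
`T_ab = Σλ^{3ℓ}ab`, dressed defect `Q_aN_a ≤ (1+δ)T_a²` (`δ > 0`, `N_a, N_b > 0`): `|T_ab − (T_a/N_a)·N_ab| ≤ √δ·(T_a/N_a)·√N_a·√N_b`. [cite: ReedSimonIV1978, Thm. XIII.1] -/
theorem blockCross_of_variance
    (hNa : HasSum (fun k => lam k ^ (2 * ℓ) * a k ^ 2) Na) (hTa : HasSum (fun k => lam k ^ (3 * ℓ) * a k ^ 2) Ta)
    (hQa : HasSum (fun k => lam k ^ (4 * ℓ) * a k ^ 2) Qa) (hNb : HasSum (fun k => lam k ^ (2 * ℓ) * b k ^ 2) Nb)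
    (hNab : HasSum (fun k => lam k ^ (2 * ℓ) * (a k * b k)) Nab) (hTab : HasSum (fun k => lam k ^ (3 * ℓ) * (a k * b k)) Tab)
    (hNa0 : 0 < Na) (hNb0 : 0 < Nb) (hδ : 0 < δ) (hTa0 : 0 < Ta) (H2 : Qa * Na ≤ (1 + δ) * Ta ^ 2) :
    |Tab - Ta / Na * Nab| ≤ Real.sqrt δ * (Ta / Na) * (Real.sqrt Na * Real.sqrt Nb) := by
  set Xb := Ta / Na with hXb
  have hXb0 : 0 < Xb := div_pos hTa0 hNa0
  -- the signed series and its AM–GM domination with parameter τ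
  have hF : HasSum (fun k => lam k ^ (2 * ℓ) * (a k * b k) * (lam k ^ ℓ - Xb)) (Tab - Xb * Nab) := by
    have := hTab.sub (hNab.mul_left Xb)
    refine this.congr_fun fun k => ?_
    simp only [pow_two_mul_eq, pow_three_mul_eq]; ring
  have hV := hasSum_dressed_centred hNa hTa hQa Xb
  have hv2 := dressed_var_le hNa0 H2
  rw [← hXb] at hv2
  have hsδ : 0 < Real.sqrt δ := Real.sqrt_pos.2 hδ
  have hsa : 0 < Real.sqrt Na := Real.sqrt_pos.2 hNa0
  have hsb : 0 < Real.sqrt Nb := Real.sqrt_pos.2 hNb0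
  set p := Real.sqrt δ * Xb * Real.sqrt Na with hpdef
  set q := Real.sqrt Nb with hqdef
  have hp : 0 < p := by rw [hpdef]; positivity
  have hq : 0 < q := hsb
  have hp2 : p ^ 2 = δ * (Xb ^ 2 * Na) := by
    rw [hpdef, mul_pow, mul_pow, Real.sq_sqrt hδ.le, Real.sq_sqrt hNa0.le]; ring
  have hq2 : q ^ 2 = Nb := Real.sq_sqrt hNb0.le
  set τ := q / p with hτdef
  have hτ : 0 < τ := div_pos hq hp
  have hG : HasSum (fun k => (τ * (lam k ^ (2 * ℓ) * a k ^ 2 * (lam k ^ ℓ - Xb) ^ 2) + lam k ^ (2 * ℓ) * b k ^ 2 / τ) / 2)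
      ((τ * (Qa - 2 * Xb * Ta + Xb ^ 2 * Na) + Nb / τ) / 2) :=
    ((hV.mul_left τ).add (hNb.div_const τ)).div_const 2
  have hpt : ∀ k, |lam k ^ (2 * ℓ) * (a k * b k) * (lam k ^ ℓ - Xb)| ≤
      (τ * (lam k ^ (2 * ℓ) * a k ^ 2 * (lam k ^ ℓ - Xb) ^ 2) + lam k ^ (2 * ℓ) * b k ^ 2 / τ) / 2 := by
    intro k
    have h := abs_mul_le_amgm hτ (lam k ^ ℓ * a k * (lam k ^ ℓ - Xb)) (lam k ^ ℓ * b k)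
    have hid : lam k ^ (2 * ℓ) * (a k * b k) * (lam k ^ ℓ - Xb) = (lam k ^ ℓ * a k * (lam k ^ ℓ - Xb)) * (lam k ^ ℓ * b k) := by
      rw [pow_two_mul_eq]; ring
    rw [hid]
    calc _ ≤ (τ * (lam k ^ ℓ * a k * (lam k ^ ℓ - Xb)) ^ 2 + (lam k ^ ℓ * b k) ^ 2 / τ) / 2 := h
      _ = _ := by rw [pow_two_mul_eq]; ring
  have hle1 := hasSum_le (fun k => (abs_le.1 (hpt k)).2) hF hG
  have hle2 := hasSum_le (fun k => neg_le.1 (abs_le.1 (hpt k)).1) hF.neg hG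
  -- evaluate the bound at this τ: τ·V2 ≤ τ δ Xb² Na = √δ Xb √Na √Nb and Nb/τ = √δ Xb √Na √Nb
  have hpq : Real.sqrt δ * Xb * (Real.sqrt Na * Real.sqrt Nb) = p * q := by rw [hpdef, hqdef]; ring
  have hτV : τ * (Qa - 2 * Xb * Ta + Xb ^ 2 * Na) ≤ p * q := by
    have h1 := mul_le_mul_of_nonneg_left hv2 hτ.le
    have hid : τ * (δ * (Xb ^ 2 * Na)) = p * q := by
      rw [← hp2, hτdef]; field_simp
    linarith [hid]
  have hτN : Nb / τ = p * q := by
    rw [← hq2, hτdef]; field_simp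
  rw [hpq, abs_le]; constructor <;> nlinarith [hle1, hle2, hτV, hτN]

end SpecSum

namespace BlockToFine

variable {L : ℕ} [NeZero L]

/-- ★ **BLOCK CROSS FROM DRESSED BLOCK DEFECTS**: for `u = K^ℓv`, `u' = K^ℓw` (`v, w` physical, `β > 0`, `ℓ ≥ 1`) with dressed block defects `≤ δ` (`δ > 0`),
`|⟨u,K^ℓu'⟩ − ((X̄+X̄')/2)⟨u,u'⟩| ≤ √δ·((X̄+X̄')/2)·‖u‖‖u'‖`, `X̄ = ⟨u,K^ℓu⟩/‖u‖²`.  Hence (B6) of r9 at `√δ` — free at `δ = O(λ⁴)`. [cite: ReedSimonIV1978, Thm. XIII.1] -/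
theorem blockCross_of_defects {β : ℝ} (hβ : 0 < β) {v w : GaugeConfig 3 L SU2 → ℝ} (hv : IsPhys v) (hw : IsPhys w) {ℓ : ℕ} (hℓ : 1 ≤ ℓ)
    {δ : ℝ} (hδ : 0 < δ)
    (hposv : 0 < l2 ((transferApply β)^[ℓ] v) ((transferApply β)^[ℓ] v))
    (hposw : 0 < l2 ((transferApply β)^[ℓ] w) ((transferApply β)^[ℓ] w))
    (hTv : 0 < l2 ((transferApply β)^[ℓ] v) ((transferApply β)^[2 * ℓ] v))
    (hTw : 0 < l2 ((transferApply β)^[ℓ] w) ((transferApply β)^[2 * ℓ] w))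
    (hdressv : l2 ((transferApply β)^[ℓ] v) ((transferApply β)^[3 * ℓ] v) * l2 ((transferApply β)^[ℓ] v) ((transferApply β)^[ℓ] v) ≤
      (1 + δ) * l2 ((transferApply β)^[ℓ] v) ((transferApply β)^[2 * ℓ] v) ^ 2)
    (hdressw : l2 ((transferApply β)^[ℓ] w) ((transferApply β)^[3 * ℓ] w) * l2 ((transferApply β)^[ℓ] w) ((transferApply β)^[ℓ] w) ≤
      (1 + δ) * l2 ((transferApply β)^[ℓ] w) ((transferApply β)^[2 * ℓ] w) ^ 2) :
    let n := l2 ((transferApply β)^[ℓ] v) ((transferApply β)^[ℓ] v)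
    let n' := l2 ((transferApply β)^[ℓ] w) ((transferApply β)^[ℓ] w)
    let X := l2 ((transferApply β)^[ℓ] v) ((transferApply β)^[2 * ℓ] v) / n
    let X' := l2 ((transferApply β)^[ℓ] w) ((transferApply β)^[2 * ℓ] w) / n'
    |l2 ((transferApply β)^[ℓ] v) ((transferApply β)^[2 * ℓ] w) - (X + X') / 2 * l2 ((transferApply β)^[ℓ] v) ((transferApply β)^[ℓ] w)| ≤
      Real.sqrt δ * ((X + X') / 2) * (Real.sqrt n * Real.sqrt n') := by
  intro n n' X X'
  obtain ⟨lam, a, b, Aa, Ab, hnn, -, -, -, -, hNa, -, hTa, hQa, -, -, -, hNb, -, hTb, hQb, hNab, -, hTab⟩ := exists_cross_data hβ hv hw hℓ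
  -- symmetric copy: the data with the roles of v and w exchanged (cross sums are symmetric in a, b)
  have hNba : HasSum (fun k => lam k ^ (2 * ℓ) * (b k * a k)) (l2 ((transferApply β)^[ℓ] v) ((transferApply β)^[ℓ] w)) :=
    hNab.congr_fun fun k => by ring
  have hTba : HasSum (fun k => lam k ^ (3 * ℓ) * (b k * a k)) (l2 ((transferApply β)^[ℓ] v) ((transferApply β)^[2 * ℓ] w)) :=
    hTab.congr_fun fun k => by ring
  have h1 := SpecSum.blockCross_of_variance hNa hTa hQa hNb hNab hTab hposv hposw hδ hTv hdressv
  have h2 := SpecSum.blockCross_of_variance hNb hTb hQb hNa hNba hTba hposw hposv hδ hTw hdressw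
  -- average the two
  have hsplit : l2 ((transferApply β)^[ℓ] v) ((transferApply β)^[2 * ℓ] w) - (X + X') / 2 * l2 ((transferApply β)^[ℓ] v) ((transferApply β)^[ℓ] w) =
      ((l2 ((transferApply β)^[ℓ] v) ((transferApply β)^[2 * ℓ] w) - X * l2 ((transferApply β)^[ℓ] v) ((transferApply β)^[ℓ] w)) +
        (l2 ((transferApply β)^[ℓ] v) ((transferApply β)^[2 * ℓ] w) - X' * l2 ((transferApply β)^[ℓ] v) ((transferApply β)^[ℓ] w))) / 2 := by ring
  rw [hsplit, abs_div, abs_two]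
  have := abs_add_le (l2 ((transferApply β)^[ℓ] v) ((transferApply β)^[2 * ℓ] w) - X * l2 ((transferApply β)^[ℓ] v) ((transferApply β)^[ℓ] w))
    (l2 ((transferApply β)^[ℓ] v) ((transferApply β)^[2 * ℓ] w) - X' * l2 ((transferApply β)^[ℓ] v) ((transferApply β)^[ℓ] w))
  have hcomm : Real.sqrt n' * Real.sqrt n = Real.sqrt n * Real.sqrt n' := mul_comm _ _
  rw [hcomm] at h2
  rw [div_le_iff₀ (by norm_num : (0:ℝ) < 2)]
  nlinarith [h1, h2, this]

end BlockToFine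

end Summit.QuantumFields.YangMills.Theorems.FemtoTransferGap

end
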